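import Summits.BirchSwinnertonDyer.BirchSwinnertonDyer.Theorems.EisensteinPrimesB11L3RiemannSumDoor
import Summits.BirchSwinnertonDyer.BirchSwinnertonDyer.Theorems.EisensteinPrimesB11L3MainConjectureCoeff
import HarnessLib

/-!
# Row B11 (crux 4 `BSDpOnCellC`, stmt-BirchSwinnertonDyer-19034) — lever L3, §5: the RIEMANN-SUM reading as a
# TRANSPORT LEMMA, and `BSD(E,p) ∧ Mazur's main conjecture at the pair` from ONE exact Riemann sum

Cell `bsd-eis` (HOME `run/shared/lean/pub/bsd-eis/`), seat `bsd-eis-k5-p3` gen 3 (prover). Companion of §4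
(`EisensteinPrimesB11L3RiemannSumDoor.lean`, p554666). There the transport «ONE level `n` with
`p⁻ⁿ/‖k!‖_p < ‖RS k n‖` ⟹ `‖[T^k]L‖ = ‖RS k n‖ ∧ [T^k]L ≠ 0` for every `L` of the package, `k = 1 + e`» was
inlined into the two `BSDp` doors. HERE it is stated ONCE as a lemma turning the Riemann-sum form of the L3
certificate (what the engines B / C / E read: the `T^(1+e)`-coefficient of a finite-level Mazur–Tate element and
its `p`-adic size) into the COEFFICIENT form consumed by every L3 door of the tree (k5-p3 g2 §3 p545218 `BSDp`;
k5-c4 g10 p548943 `MazurMainConjectureAt`; g2 p546788/p548574 MC / Schneider), and the `BSDp ∧ MC` doors are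
derived from it — so the by-name record «Mazur's main conjecture at the pair» of the L3 tables (planner g24
RULING L92 «OFFER-EIS-B11S-MC») has the same kernel-exact reading rule as `BSDp`.

WHAT IS PROVED (theorems only; `--supports` the item as a helper, closes nothing):
* `l3CoeffCertificate_of_l3RiemannSumCertificate_split` / `_nonsplit` — TRANSPORT: at an odd multiplicative
  prime in positive analytic rank (`C = 1` plus-symbol bound,
  `IsNewformOf.norm_ratPlusSymbol_val_div_le_one_of_multiplicative_of_analyticRank_ne_zero`), the RS-form
  certificate implies the coefficient-form certificate (`IsSplitMultPAdicLFunctionOf.norm_coeff_eq_of_split_of_lt`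
  / `IsMultPAdicLFunctionOf.norm_coeff_eq_of_nonsplit_of_lt` + `valuation_mul₃_congr`).
* `bsdp_and_mazurMainConjectureAt_of_cellC_of_split_of_thm16_of_l3RiemannSumCertificate` / `_not_split_` —
  `CellC W p` ∧ sign ∧ RS-form certificate ∧ `p ∤ #Ш_an` ⟹ `BSDp W p ∧ X2.MazurMainConjectureAt W p`
  (k5-c4's `bsdp_and_mazurMainConjectureAt_of_cellC_of_{split,not_split}_of_thm16_of_l3CoeffCertificate` ∘ transport).

HONEST FRAMING: per-pair CONDITIONAL theorems; readings enter as hypotheses; nothing booked; X2c stays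
CONSTRUCTION-SHAPED as a class; BSD / Mazur's MC proved unconditionally for no curve.

References: [MazurTateTeitelbaum1986Invent] §I.10 Prop., §I.11, §I.14 (14.3); [SteinWuthrich2013] §3, §4.2,
Thm. 6.1 (p. 20); [Wuthrich2014] Thm. 16 (p. 397); [Miller2011LMS] Def. 1.1, Prop. 7.6.
-/

set_option linter.dupNamespace false
set_option autoImplicit false

noncomputable section

open scoped Classical MatrixGroups ModularForm

open WeierstrassCurve PowerSeries CongruenceSubgroup
  Literature.NumberTheory.EllipticCurves
  Literature.NumberTheory.EllipticCurves.ModularForms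
  Literature.NumberTheory.EllipticCurves.Rank1Residual
  Literature.NumberTheory.EllipticCurves.Rank1Residual.Typed
  Literature.NumberTheory.EllipticCurves.Wuthrich2014
  Literature.NumberTheory.EllipticCurves.SteinWuthrich2013
  Literature.NumberTheory.EllipticCurves.Disegni2020
  Summit.BirchSwinnertonDyer.Rank1Residual
  Summit.BirchSwinnertonDyer.Rank1Residual.X2

namespace Summit.BirchSwinnertonDyer.BirchSwinnertonDyer.Theorems.B11L3

variable (W : WeierstrassCurve ℚ) [W.IsElliptic] [W.IsGloballyMinimal] (p : ℕ) [Fact p.Prime]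

/-! ## §5.1 Transport: Riemann-sum certificate ⟹ coefficient certificate -/

omit [W.IsGloballyMinimal] in
/-- **TRANSPORT, split `p ‖ N`.** At an odd (`p ≠ 2`) split multiplicative prime with `r_an(W) ≠ 0`, the
Riemann-sum form of the L3 certificate (for THE newform `f`, `ϖ`, the Riemann sums `RS` of `[·]⁺_f`, THE Tate
datum, THE §4.2 height: ONE `n` with `p⁻ⁿ/‖2!‖_p < ‖RS 2 n‖` and the valuation identity ON `RS 2 n`) implies
its coefficient form (`[T²]L ≠ 0` and the identity ON `[T²]L`, for every `L` with `IsSplitMultPAdicLFunctionOf f p L`).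
[cite: MazurTateTeitelbaum1986Invent, §I.11 and §I.14 (14.3)] [cite: SteinWuthrich2013, §3 and §4.2] -/
theorem l3CoeffCertificate_of_l3RiemannSumCertificate_split (hp2 : p ≠ 2) (hr : W.analyticRank ≠ 0)
    (hsplit : W.HasSplitMultiplicativeReductionAtPrime p)
    (hcert : ∀ {N : ℕ} [NeZero N] (f : CuspForm (Gamma0 N) 2), IsNewformOf W f →
      ∀ (ϖ : ℚ), (ϖ : ℝ) * W.realPeriodRat = plusPeriod f →
      ∀ (RS : ℕ → ℕ → ℚ_[p]), (∀ k n : ℕ, RS k n =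
        ∑ᶠ ξ : rootsOfUnity (torsionOrder p) ℤ_[p], ∑ s : ZMod (p ^ n),
          (fun (n : ℕ) (a : ZMod (p ^ n)) ↦ (ratPlusSymbol f ((a.val : ℚ) / (p : ℚ) ^ n) : ℚ_[p]))
            (n + cyclotomicExponent p)
              (PadicInt.toZModPow (n + cyclotomicExponent p) ((ξ : ℤ_[p]ˣ) : ℤ_[p]) *
                (cyclotomicGenerator p : ZMod (p ^ (n + cyclotomicExponent p))) ^ s.val) *
            ((s.val.choose k : ℕ) : ℚ_[p])) →
      ∀ (Dq : TateParameterData W p) (Dh : PAdicHeightData W p), IsSplitMultCanonical Dh Dq →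
        ∃ n : ℕ, 1 / ‖((Nat.factorial 2 : ℕ) : ℚ_[p])‖ * (p : ℝ) ^ (-n : ℤ) < ‖RS 2 n‖ ∧
        (((ϖ : ℚ) : ℚ_[p]) * RS 2 n *
            (padicLog p (cyclotomicGenerator p) ^ 2 * (W.torsionOrder : ℚ_[p]) ^ 2)).valuation =
          (LInvariant Dq * (W.tamagawaProduct : ℚ_[p]) * padicRegulator Dh).valuation) :
    ∀ {N : ℕ} [NeZero N] (f : CuspForm (Gamma0 N) 2), IsNewformOf W f →
      ∀ (ϖ : ℚ), (ϖ : ℝ) * W.realPeriodRat = plusPeriod f →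
      ∀ (L : PowerSeries ℚ_[p]), IsSplitMultPAdicLFunctionOf f p L →
      ∀ (Dq : TateParameterData W p) (Dh : PAdicHeightData W p), IsSplitMultCanonical Dh Dq →
        PowerSeries.coeff 2 L ≠ 0 ∧
        (((ϖ : ℚ) : ℚ_[p]) * PowerSeries.coeff 2 L *
            (padicLog p (cyclotomicGenerator p) ^ 2 * (W.torsionOrder : ℚ_[p]) ^ 2)).valuation =
          (LInvariant Dq * (W.tamagawaProduct : ℚ_[p]) * padicRegulator Dh).valuation := by
  intro N _ f hf ϖ hϖ L hL Dq Dh hDh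
  set RS : ℕ → ℕ → ℚ_[p] := fun k n ↦
    ∑ᶠ ξ : rootsOfUnity (torsionOrder p) ℤ_[p], ∑ s : ZMod (p ^ n),
      (fun (n : ℕ) (a : ZMod (p ^ n)) ↦ (ratPlusSymbol f ((a.val : ℚ) / (p : ℚ) ^ n) : ℚ_[p]))
        (n + cyclotomicExponent p)
          (PadicInt.toZModPow (n + cyclotomicExponent p) ((ξ : ℤ_[p]ˣ) : ℤ_[p]) *
            (cyclotomicGenerator p : ZMod (p ^ (n + cyclotomicExponent p))) ^ s.val) *
        ((s.val.choose k : ℕ) : ℚ_[p]) with hRSdef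
  have hRS : ∀ k n : ℕ, RS k n = _ := fun k n ↦ by rw [hRSdef]
  obtain ⟨n, hlt, hval⟩ := hcert f hf ϖ hϖ RS hRS Dq Dh hDh
  have hC : ∀ (m : ℕ) (a : ZMod (p ^ m)),
      ‖(ratPlusSymbol f ((a.val : ℚ) / (p : ℚ) ^ m) : ℚ_[p])‖ ≤ 1 := fun m a ↦
    hf.norm_ratPlusSymbol_val_div_le_one_of_multiplicative_of_analyticRank_ne_zero hp2
      hsplit.hasMultiplicativeReductionAtPrime hr m a
  obtain ⟨hnorm, hcoeff⟩ := hL.norm_coeff_eq_of_split_of_lt hRS hsplit hf hC (k := 2) (n := n) hlt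
  refine ⟨hcoeff, ?_⟩
  have hRS0 : RS 2 n ≠ 0 := by
    intro h0
    rw [h0, norm_zero] at hnorm
    exact hcoeff (norm_eq_zero.mp hnorm)
  rw [← hval]
  exact valuation_mul₃_congr hcoeff hRS0 hnorm

omit [W.IsGloballyMinimal] in
/-- **TRANSPORT, non-split `p ‖ N`** (signed measure `(−1)ⁿ[a/pⁿ]⁺_f`, `k = 1`): the Riemann-sum form of the L3
certificate implies its coefficient form for every `L` with `IsMultPAdicLFunctionOf f p (-1) L`.
[cite: MazurTateTeitelbaum1986Invent, §I.11 and §I.14 (14.3)] [cite: SteinWuthrich2013, §3 and §4.2] -/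
theorem l3CoeffCertificate_of_l3RiemannSumCertificate_nonsplit (hp2 : p ≠ 2) (hr : W.analyticRank ≠ 0)
    (hmult : W.HasMultiplicativeReductionAtPrime p) (hns : ¬ W.HasSplitMultiplicativeReductionAtPrime p)
    (hcert : ∀ {N : ℕ} [NeZero N] (f : CuspForm (Gamma0 N) 2), IsNewformOf W f →
      ∀ (ϖ : ℚ), (ϖ : ℝ) * W.realPeriodRat = plusPeriod f →
      ∀ (RS : ℕ → ℕ → ℚ_[p]), (∀ k n : ℕ, RS k n =
        ∑ᶠ ξ : rootsOfUnity (torsionOrder p) ℤ_[p], ∑ s : ZMod (p ^ n),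
          (fun (n : ℕ) (a : ZMod (p ^ n)) ↦
              (-1 : ℚ_[p]) ^ n * (ratPlusSymbol f ((a.val : ℚ) / (p : ℚ) ^ n) : ℚ_[p]))
            (n + cyclotomicExponent p)
              (PadicInt.toZModPow (n + cyclotomicExponent p) ((ξ : ℤ_[p]ˣ) : ℤ_[p]) *
                (cyclotomicGenerator p : ZMod (p ^ (n + cyclotomicExponent p))) ^ s.val) *
            ((s.val.choose k : ℕ) : ℚ_[p])) →
      ∀ (q : ℚ_[p]), q ≠ 0 → ‖q‖ < 1 → tateJ q = (W.j : ℚ_[p]) →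
      ∀ (Dh : PAdicHeightData W p), IsMultCanonical Dh q →
        ∃ n : ℕ, 1 / ‖((Nat.factorial 1 : ℕ) : ℚ_[p])‖ * (p : ℝ) ^ (-n : ℤ) < ‖RS 1 n‖ ∧
        (((ϖ : ℚ) : ℚ_[p]) * RS 1 n *
            (padicLog p (cyclotomicGenerator p) ^ 1 * (W.torsionOrder : ℚ_[p]) ^ 2)).valuation =
          (2 * (W.tamagawaProduct : ℚ_[p]) * padicRegulator Dh).valuation) :
    ∀ {N : ℕ} [NeZero N] (f : CuspForm (Gamma0 N) 2), IsNewformOf W f →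
      ∀ (ϖ : ℚ), (ϖ : ℝ) * W.realPeriodRat = plusPeriod f →
      ∀ (L : PowerSeries ℚ_[p]), IsMultPAdicLFunctionOf f p (-1) L →
      ∀ (q : ℚ_[p]), q ≠ 0 → ‖q‖ < 1 → tateJ q = (W.j : ℚ_[p]) →
      ∀ (Dh : PAdicHeightData W p), IsMultCanonical Dh q →
        PowerSeries.coeff 1 L ≠ 0 ∧
        (((ϖ : ℚ) : ℚ_[p]) * PowerSeries.coeff 1 L *
            (padicLog p (cyclotomicGenerator p) ^ 1 * (W.torsionOrder : ℚ_[p]) ^ 2)).valuation =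
          (2 * (W.tamagawaProduct : ℚ_[p]) * padicRegulator Dh).valuation := by
  intro N _ f hf ϖ hϖ L hL q hq0 hq1 hqj Dh hDh
  set RS : ℕ → ℕ → ℚ_[p] := fun k n ↦
    ∑ᶠ ξ : rootsOfUnity (torsionOrder p) ℤ_[p], ∑ s : ZMod (p ^ n),
      (fun (n : ℕ) (a : ZMod (p ^ n)) ↦
          (-1 : ℚ_[p]) ^ n * (ratPlusSymbol f ((a.val : ℚ) / (p : ℚ) ^ n) : ℚ_[p]))
        (n + cyclotomicExponent p)
          (PadicInt.toZModPow (n + cyclotomicExponent p) ((ξ : ℤ_[p]ˣ) : ℤ_[p]) *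
            (cyclotomicGenerator p : ZMod (p ^ (n + cyclotomicExponent p))) ^ s.val) *
        ((s.val.choose k : ℕ) : ℚ_[p]) with hRSdef
  have hRS : ∀ k n : ℕ, RS k n = _ := fun k n ↦ by rw [hRSdef]
  obtain ⟨n, hlt, hval⟩ := hcert f hf ϖ hϖ RS hRS q hq0 hq1 hqj Dh hDh
  have hC : ∀ (m : ℕ) (a : ZMod (p ^ m)),
      ‖(ratPlusSymbol f ((a.val : ℚ) / (p : ℚ) ^ m) : ℚ_[p])‖ ≤ 1 := fun m a ↦
    hf.norm_ratPlusSymbol_val_div_le_one_of_multiplicative_of_analyticRank_ne_zero hp2 hmult hr m a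
  obtain ⟨hnorm, hcoeff⟩ := hL.norm_coeff_eq_of_nonsplit_of_lt hRS hf hmult hns hC (k := 1) (n := n) hlt
  refine ⟨hcoeff, ?_⟩
  have hRS0 : RS 1 n ≠ 0 := by
    intro h0
    rw [h0, norm_zero] at hnorm
    exact hcoeff (norm_eq_zero.mp hnorm)
  rw [← hval]
  exact valuation_mul₃_congr hcoeff hRS0 hnorm

/-! ## §5.2 `BSD(E,p)` AND Mazur's main conjecture at the pair from ONE exact Riemann sum -/

/-- **X2c, SPLIT `p ‖ N` — ONE Riemann-sum certificate (+ `p ∤ #Ш_an`): `BSD(E,p)` AND Mazur's main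
conjecture at the pair** (k5-c4's `bsdp_and_mazurMainConjectureAt_of_cellC_of_split_of_thm16_of_l3CoeffCertificate`,
p548943, after the transport of §5.1). [cite: Wuthrich2014, Thm. 16 (p. 397)]
[cite: SteinWuthrich2013, Thm. 6.1 (p. 20) and §4.2] [cite: Miller2011LMS, Def. 1.1 and Prop. 7.6] -/
theorem bsdp_and_mazurMainConjectureAt_of_cellC_of_split_of_thm16_of_l3RiemannSumCertificate
    (hWu : thm16_charIdeal_dvd_multiplicative_of_reducible) (hJs : thm61_splitMultiplicative)
    (hGZ : GrossZagier1986_thm_I_7_3) (hGZK : rank_eq_analyticRank_of_analyticRank_le_one)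
    (hpar : nonempty_modularParametrizationData)
    (hc : CellC W p) (hsplit : W.HasSplitMultiplicativeReductionAtPrime p)
    (hcert : ∀ {N : ℕ} [NeZero N] (f : CuspForm (Gamma0 N) 2), IsNewformOf W f →
      ∀ (ϖ : ℚ), (ϖ : ℝ) * W.realPeriodRat = plusPeriod f →
      ∀ (RS : ℕ → ℕ → ℚ_[p]), (∀ k n : ℕ, RS k n =
        ∑ᶠ ξ : rootsOfUnity (torsionOrder p) ℤ_[p], ∑ s : ZMod (p ^ n),
          (fun (n : ℕ) (a : ZMod (p ^ n)) ↦ (ratPlusSymbol f ((a.val : ℚ) / (p : ℚ) ^ n) : ℚ_[p]))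
            (n + cyclotomicExponent p)
              (PadicInt.toZModPow (n + cyclotomicExponent p) ((ξ : ℤ_[p]ˣ) : ℤ_[p]) *
                (cyclotomicGenerator p : ZMod (p ^ (n + cyclotomicExponent p))) ^ s.val) *
            ((s.val.choose k : ℕ) : ℚ_[p])) →
      ∀ (Dq : TateParameterData W p) (Dh : PAdicHeightData W p), IsSplitMultCanonical Dh Dq →
        ∃ n : ℕ, 1 / ‖((Nat.factorial 2 : ℕ) : ℚ_[p])‖ * (p : ℝ) ^ (-n : ℤ) < ‖RS 2 n‖ ∧
        (((ϖ : ℚ) : ℚ_[p]) * RS 2 n *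
            (padicLog p (cyclotomicGenerator p) ^ 2 * (W.torsionOrder : ℚ_[p]) ^ 2)).valuation =
          (LInvariant Dq * (W.tamagawaProduct : ℚ_[p]) * padicRegulator Dh).valuation)
    (hsha : ∀ s : ℚ, shaAn W = (s : ℂ) → padicValRat p s = 0) :
    BSDp W p ∧ MazurMainConjectureAt W p :=
  bsdp_and_mazurMainConjectureAt_of_cellC_of_split_of_thm16_of_l3CoeffCertificate W p hWu hJs hGZ hGZK hpar
    hc hsplit
    (l3CoeffCertificate_of_l3RiemannSumCertificate_split W p hc.2.1 (by rw [hc.1]; exact one_ne_zero)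
      hsplit hcert)
    hsha

/-- **X2c, NON-split `p ‖ N` — ONE Riemann-sum certificate (+ `p ∤ #Ш_an`): `BSD(E,p)` AND Mazur's main
conjecture at the pair** (k5-c4's `…_not_split_of_thm16_of_l3CoeffCertificate`, p548943, after §5.1).
[cite: Wuthrich2014, Thm. 16 (p. 397)] [cite: SteinWuthrich2013, Thm. 6.1 (p. 20), §3.1 (p. 9), §4.2]
[cite: Miller2011LMS, Def. 1.1 and Prop. 7.6] -/
theorem bsdp_and_mazurMainConjectureAt_of_cellC_of_not_split_of_thm16_of_l3RiemannSumCertificate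
    (hWu : thm16_charIdeal_dvd_multiplicative_of_reducible) (hJn : thm61_nonsplitMultiplicative)
    (hGZ : GrossZagier1986_thm_I_7_3) (hGZK : rank_eq_analyticRank_of_analyticRank_le_one)
    (hpar : nonempty_modularParametrizationData)
    (hc : CellC W p) (hns : ¬ W.HasSplitMultiplicativeReductionAtPrime p)
    (hcert : ∀ {N : ℕ} [NeZero N] (f : CuspForm (Gamma0 N) 2), IsNewformOf W f →
      ∀ (ϖ : ℚ), (ϖ : ℝ) * W.realPeriodRat = plusPeriod f →
      ∀ (RS : ℕ → ℕ → ℚ_[p]), (∀ k n : ℕ, RS k n =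
        ∑ᶠ ξ : rootsOfUnity (torsionOrder p) ℤ_[p], ∑ s : ZMod (p ^ n),
          (fun (n : ℕ) (a : ZMod (p ^ n)) ↦
              (-1 : ℚ_[p]) ^ n * (ratPlusSymbol f ((a.val : ℚ) / (p : ℚ) ^ n) : ℚ_[p]))
            (n + cyclotomicExponent p)
              (PadicInt.toZModPow (n + cyclotomicExponent p) ((ξ : ℤ_[p]ˣ) : ℤ_[p]) *
                (cyclotomicGenerator p : ZMod (p ^ (n + cyclotomicExponent p))) ^ s.val) *
            ((s.val.choose k : ℕ) : ℚ_[p])) →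
      ∀ (q : ℚ_[p]), q ≠ 0 → ‖q‖ < 1 → tateJ q = (W.j : ℚ_[p]) →
      ∀ (Dh : PAdicHeightData W p), IsMultCanonical Dh q →
        ∃ n : ℕ, 1 / ‖((Nat.factorial 1 : ℕ) : ℚ_[p])‖ * (p : ℝ) ^ (-n : ℤ) < ‖RS 1 n‖ ∧
        (((ϖ : ℚ) : ℚ_[p]) * RS 1 n *
            (padicLog p (cyclotomicGenerator p) ^ 1 * (W.torsionOrder : ℚ_[p]) ^ 2)).valuation =
          (2 * (W.tamagawaProduct : ℚ_[p]) * padicRegulator Dh).valuation)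
    (hsha : ∀ s : ℚ, shaAn W = (s : ℂ) → padicValRat p s = 0) :
    BSDp W p ∧ MazurMainConjectureAt W p :=
  bsdp_and_mazurMainConjectureAt_of_cellC_of_not_split_of_thm16_of_l3CoeffCertificate W p hWu hJn hGZ hGZK
    hpar hc hns
    (l3CoeffCertificate_of_l3RiemannSumCertificate_nonsplit W p hc.2.1 (by rw [hc.1]; exact one_ne_zero)
      hc.2.2.2 hns hcert)
    hsha

end Summit.BirchSwinnertonDyer.BirchSwinnertonDyer.Theorems.B11L3

end
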